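import Mathlib
import Summits.Ventures.HodgeRepro.Tier4.Common.Forms

/-!
# Tier4/Common/Geometry — the geometric side of (P): Hecke translates, the four corner `1`-forms, `f^*Ω_s`, `f^*Ω_{s̄}`

Blind re-derivation cell `pub-hodge-repro`, Tier 4 (README §9–§10), seat t4-typer-1 (gen 0).  Target tree path
`lean/Summits/Ventures/HodgeRepro/Tier4/Common/Geometry.lean`.  Imports the seam `Tier4/Common/Forms.lean`
(`FormAlgebra Form`: the holomorphic forms of the compact `2`-ball quotient `X`, their wedge and the `L²(X)` pairing).

THE SENTENCE (route/TIER3.md §1 item 3): «**(P) for some choice of the Hecke translates,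
⟨f^*Ω_s, f^*Ω_{s̄}⟩_{L²(X)} ≠ 0** — X a compact 2-ball quotient (Picard modular surface of an anisotropic hermitian
3-space V over a Galois CM field E′ ⊇ F, [E′⁺:ℚ] ≥ 2) whose Albanese has the four corners as isogeny factors (Liu 2021
Cor 4.20, UNCONDITIONAL at n = 3), f the product of Hecke-translated Albanese maps, f^*Ω_s = θ(μ_0) ∧ θ(μ_1) and
f^*Ω_{s̄} = θ(μ_2) ∧ θ(μ_3) wedges of theta lifts of U(1)-characters (BMM Cor 65 / Liu Prop 4.13, PRINTED)».

WHAT IS TYPED HERE (the geometric objects, as parameters with their defining properties; nothing automorphic):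
* `HeckeAction A` — **the Hecke translates**: the Hecke correspondences `T` of the level (the Hecke algebra `ℋ_K`
  acting as correspondences on a common congruence cover of `X`) through their action `T ↦ T^*` on the holomorphic
  forms of `X` (pull-back along one leg, push-forward along the other), ℂ-linear and preserving the Hodge type.
  «For some choice of the Hecke translates» = for some `γ : Fin 4 → Hecke`, one translate per Albanese component.
* `Witness A` — **the witness `X` with its four corner forms**: `X` is a compact `2`-ball quotient whose Albanese
  `Alb(X)` has the four corners `A_{T_0}, …, A_{T_3}` of the rank-four face as isogeny factors; the Albanese map
  followed by the projection to the corner, `alb_i : X → Alb(X) → A_{T_i}`, pulls the eigen-`1`-form `ω_{i,s}`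
  (`i = 0, 1`: the two corners containing the embedding `s`) resp. `ω_{i,s̄}` (`i = 2, 3`: the two containing `s̄`)
  back to a holomorphic `1`-form `omega i` on `X`.  Because `A_{T_i}` is an isogeny factor of `Alb(X)`, `alb_i` is
  dominant and the pull-back of a non-zero `1`-form is non-zero (`omega_ne`).
* the derived objects: `f^*ω_i = T_{γ_i}^* omega i`; `f^*Ω_s = f^*ω_0 ∧ f^*ω_1` (`Ω_s := ω_{0,s} ∧ ω_{1,s}` over the two
  corners containing `s`, ROUTE.md §4 item 2 «Ω_s := ∧_{i : s ∈ T_i} ω_{i,s}»), `f^*Ω_{s̄} = f^*ω_2 ∧ f^*ω_3`; the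
  number `⟨f^*Ω_s, f^*Ω_{s̄}⟩_{L²(X)}`; and **`Witness.P`** = the sentence (P).
The identification `f^*ω_i = θ(μ_i)` with theta lifts of `U(1)`-characters is the automorphic side
(`Tier4/Common/Automorphic.lean`, typer-2) and is NOT built into anything here.

WHAT AN INTERFACE CAN AND CANNOT SAY.  Every field is a parameter; a theorem proved over these structures is a
theorem about every instantiation and exactly as strong as the listed properties.  Nothing here says anything about
the status of the Hodge conjecture for CM abelian varieties, which is NOT proved (HC_CM is NOT proved by anyone in
this repository).
-/

set_option autoImplicit false

noncomputable section

namespace Summit.Ventures.HodgeRepro.Tier4.Common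

/-- **The Hecke translates of `X`**: the Hecke correspondences of the level acting ℂ-linearly on the holomorphic forms
of `X` by `T ↦ T^*` (pull-back–push-forward along the correspondence), the identity correspondence acting trivially,
the Hodge type preserved (`1`-forms to `1`-forms, `2`-forms to `2`-forms). -/
structure HeckeAction {Form : Type} [AddCommGroup Form] [Module ℂ Form] (A : FormAlgebra Form) where
  /-- the Hecke correspondences `T` of the level (the elements of the Hecke algebra `ℋ_K` acting on a common
  congruence cover of `X`) -/
  Hecke : Type
  /-- the identity correspondence -/
  one : Hecke
  /-- the action `T^*` of the correspondence `T` on holomorphic forms, ℂ-linear -/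
  translate : Hecke → (Form →ₗ[ℂ] Form)
  /-- the identity correspondence acts as the identity -/
  translate_one : translate one = LinearMap.id
  /-- `T^*` preserves holomorphic `1`-forms -/
  translate_H10 : ∀ (T : Hecke) (α : Form), α ∈ A.H10 → translate T α ∈ A.H10
  /-- `T^*` preserves holomorphic `2`-forms -/
  translate_H20 : ∀ (T : Hecke) (α : Form), α ∈ A.H20 → translate T α ∈ A.H20

/-- **The witness `X` of (P) with its four corner `1`-forms.**  `X` is the compact `2`-ball quotient whose Albanese
has the four corners `A_{T_i}` of the face as isogeny factors; `omega i` is the pull-back to `X`, along the Albanese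
map followed by the projection to the `i`-th corner, of the eigen-`1`-form `ω_{i,s}` (`i = 0, 1`: the two corners
containing `s`) resp. `ω_{i,s̄}` (`i = 2, 3`: the two corners containing `s̄`); non-zero because the corner is an
isogeny factor of the Albanese (the pull-back of `1`-forms along a dominant map is injective).  The Hecke
translates are those of `X` (`toHeckeAction`). -/
structure Witness {Form : Type} [AddCommGroup Form] [Module ℂ Form] (A : FormAlgebra Form)
    extends HeckeAction A where
  /-- the four pulled-back corner eigen-`1`-forms `alb_i^* ω_{i,s}` (`i = 0, 1`), `alb_i^* ω_{i,s̄}` (`i = 2, 3`) -/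
  omega : Fin 4 → Form
  /-- they are holomorphic `1`-forms on `X` -/
  omega_mem : ∀ i : Fin 4, omega i ∈ A.H10
  /-- they are non-zero (the corner is an isogeny factor of `Alb(X)`) -/
  omega_ne : ∀ i : Fin 4, omega i ≠ 0

namespace Witness

variable {Form : Type} [AddCommGroup Form] [Module ℂ Form] {A : FormAlgebra Form} (W : Witness A)

/-- **A choice of the Hecke translates**: one correspondence per Albanese component, `γ = (γ_0, γ_1, γ_2, γ_3)`. -/
abbrev Translates : Type := Fin 4 → W.Hecke

/-- `f^*ω_i = T_{γ_i}^*(alb_i^* ω_i)`: the `i`-th corner form pulled back along the Hecke-translated Albanese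
component `alb_i ∘ T_{γ_i}`. -/
def pullOmega (γ : W.Translates) (i : Fin 4) : Form := W.translate (γ i) (W.omega i)

/-- `f^*Ω_s = f^*ω_0 ∧ f^*ω_1` — the wedge over the two corners containing `s`. -/
def pullOmegaS (γ : W.Translates) : Form := A.wedge (W.pullOmega γ 0) (W.pullOmega γ 1)

/-- `f^*Ω_{s̄} = f^*ω_2 ∧ f^*ω_3` — the wedge over the two corners containing `s̄`. -/
def pullOmegaSbar (γ : W.Translates) : Form := A.wedge (W.pullOmega γ 2) (W.pullOmega γ 3)

/-- **The Hodge pairing of (P)**: `⟨f^*Ω_s, f^*Ω_{s̄}⟩_{L²(X)}` for the choice `γ` of the Hecke translates. -/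
def hodgePairing (γ : W.Translates) : ℂ := A.hodge (W.pullOmegaS γ) (W.pullOmegaSbar γ)

/-- **(P)**: «for some choice of the Hecke translates, `⟨f^*Ω_s, f^*Ω_{s̄}⟩_{L²(X)} ≠ 0`». -/
def P : Prop := ∃ γ : W.Translates, W.hodgePairing γ ≠ 0

/-- The identity choice of translates (`f` = the plain product of the Albanese maps). -/
def idTranslates : W.Translates := fun _ => W.one

/-- With the identity translates `f^*ω_i` is the corner form itself. -/
theorem pullOmega_id (i : Fin 4) : W.pullOmega W.idTranslates i = W.omega i := by
  simp [pullOmega, idTranslates, W.translate_one]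

/-- Every pulled-back corner form is a holomorphic `1`-form. -/
theorem pullOmega_mem (γ : W.Translates) (i : Fin 4) : W.pullOmega γ i ∈ A.H10 :=
  W.translate_H10 _ _ (W.omega_mem i)

/-- `f^*Ω_s` is a holomorphic `2`-form. -/
theorem pullOmegaS_mem (γ : W.Translates) : W.pullOmegaS γ ∈ A.H20 :=
  A.wedge_mem _ _ (W.pullOmega_mem γ 0) (W.pullOmega_mem γ 1)

/-- `f^*Ω_{s̄}` is a holomorphic `2`-form. -/
theorem pullOmegaSbar_mem (γ : W.Translates) : W.pullOmegaSbar γ ∈ A.H20 :=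
  A.wedge_mem _ _ (W.pullOmega_mem γ 2) (W.pullOmega_mem γ 3)

/-- (P) in the seam's vocabulary: the pairing predicate of `FormAlgebra`. -/
theorem P_iff : W.P ↔ ∃ γ : W.Translates, A.PairingNonzero (W.pullOmegaS γ) (W.pullOmegaSbar γ) := Iff.rfl

/-- A non-zero pairing forces both pulled-back `2`-forms to be non-zero. -/
theorem ne_zero_of_hodgePairing_ne_zero (γ : W.Translates) (h : W.hodgePairing γ ≠ 0) :
    W.pullOmegaS γ ≠ 0 ∧ W.pullOmegaSbar γ ≠ 0 :=
  A.ne_zero_of_pairingNonzero h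

/-- (P) holds as soon as some choice of translates makes `f^*Ω_s` a non-zero multiple of `f^*Ω_{s̄}`
(positive definiteness of the `L²` pairing). -/
theorem P_of_smul_eq (γ : W.Translates) (c : ℂ) (hc : c ≠ 0) (hne : W.pullOmegaSbar γ ≠ 0)
    (h : W.pullOmegaS γ = c • W.pullOmegaSbar γ) : W.P := by
  refine ⟨γ, ?_⟩
  unfold hodgePairing
  rw [h]
  simp only [map_smul, LinearMap.smul_apply, smul_eq_mul]
  refine mul_ne_zero hc ?_
  intro h0
  exact hne (A.eq_zero_of_hodge_self_eq_zero _ h0)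

/-- (P) with the two `2`-forms equal: `f^*Ω_s = f^*Ω_{s̄} ≠ 0` for some translates. -/
theorem P_of_eq (γ : W.Translates) (hne : W.pullOmegaSbar γ ≠ 0) (h : W.pullOmegaS γ = W.pullOmegaSbar γ) :
    W.P :=
  W.P_of_smul_eq γ 1 one_ne_zero hne (by simpa using h)

end Witness

end Summit.Ventures.HodgeRepro.Tier4.Common
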